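import Summits.ABC.StewartYu.PadicG3ExitC
import HarnessLib

/-!
# Cell abc-stewartyu, Gen-3 record (WP-M3.R): clause (C) of the record — hypothesis `hCineq` of
# `RecordAssembly.recordTwo_of_ineqs` / `recordOdd_of_ineqs` for `PadicG3Par`, from the constant comparisons

`Summits/ABC/StewartYu/PadicG3ClauseC.lean` — cell `abc-stewartyu` (HOME `run/shared/lean/pub/abc-stewartyu/`),
route `PadicPrimesKummerThird`, cruxes `Y07Odd` (stmt-ABC-19658) / `Y07Two` (stmt-ABC-19659); seat lp-1 (g2),
record parcel (R3); sequel of `PadicG3ExitC.lean`.  Theorems only.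

* `exitC_two` / `exitC_odd` — the `hCineq` hypotheses of p4's `recordTwo_of_ineqs` / `recordOdd_of_ineqs`
  VERBATIM for `(V, Vmax, W, D₀, S₀, X, Λ) := (P.A, P.Amax, P.W, P.D₀, P.S₀N, P.Xfin, ρ + P.Amax)`, from:
  the instantiation convention (`K ≤ N_q ≤ 2ⁿK`, `½ ≤ θ₀`, `Amax ≤ 2ⁿΩ`, `Aⱼ ≥ 1`), the growth
  `256^{n−r}·C r ≤ C n` (`0 ≤ C r`) of the admissible constant, and the two constant comparisons
  `NC1`, `NC0` of `PadicG3ExitC` (hypotheses `hnum1`, `hnum0`).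

WHAT THIS IS NOT: no crux moves; the constant comparisons are still hypotheses here.

References: Yu. V. Nesterenko, LNM 1819 (2003), §5.2 (5.22); Prop. 2.6.
-/

noncomputable section

open Finset Real Nat

namespace Summit.ABC.StewartYu

namespace PadicG3Par

variable {n : ℕ} (P : PadicG3Par n)

/-- The final step of clause (C): from `Q·(14n+3) ≤ 256^{n−r}Ω`, the bracket bound and the growth of `C`.
[cite: Nesterenko2003, §5.2 (5.22)] -/
theorem clauseC_final {C : ℕ → ℝ} (hC0 : ∀ r, 0 ≤ C r) (hCg : ∀ r, r < n → (256 : ℝ) ^ (n - r) * C r ≤ C n)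
    {r : ℕ} (hr : r < n) {Q E : ℝ} (hQ0 : 0 < Q) (hE : 0 ≤ E)
    (hQ : Q * (14 * n + 3) ≤ (256 : ℝ) ^ (n - r) * P.Ω) :
    C r * Q * (P.W + Real.log 3 + Real.log n + Real.log P.Amax + Real.log Q + E + Real.log (2 * Q)) ≤
      C n * (∏ j, P.A j) * (P.W + E + Real.log (2 * P.Amax)) := by
  have hB := P.bracket_le hQ0 hE hQ
  have hΩ := P.Ω_pos
  have hCr := hC0 r
  have hCn := hC0 n
  have hpos : 0 < P.W + E + Real.log (2 * P.Amax) := by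
    have h1 := P.hW
    have h2 : 0 ≤ Real.log (2 * P.Amax) := Real.log_nonneg (by linarith [P.hAmax1])
    linarith
  change C r * Q * _ ≤ C n * P.Ω * _
  by_cases hneg : P.W + Real.log 3 + Real.log n + Real.log P.Amax + Real.log Q + E + Real.log (2 * Q) ≤ 0
  · calc C r * Q * (P.W + Real.log 3 + Real.log n + Real.log P.Amax + Real.log Q + E + Real.log (2 * Q))
        ≤ 0 := mul_nonpos_of_nonneg_of_nonpos (mul_nonneg hCr hQ0.le) hneg
      _ ≤ C n * P.Ω * (P.W + E + Real.log (2 * P.Amax)) := by positivity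
  · push Not at hneg
    calc C r * Q * (P.W + Real.log 3 + Real.log n + Real.log P.Amax + Real.log Q + E + Real.log (2 * Q))
        ≤ C r * Q * ((14 * n + 3) * (P.W + E + Real.log (2 * P.Amax))) :=
          mul_le_mul_of_nonneg_left hB (mul_nonneg hCr hQ0.le)
      _ = C r * (Q * (14 * n + 3)) * (P.W + E + Real.log (2 * P.Amax)) := by ring
      _ ≤ C r * ((256 : ℝ) ^ (n - r) * P.Ω) * (P.W + E + Real.log (2 * P.Amax)) := by gcongr
      _ = ((256 : ℝ) ^ (n - r) * C r) * P.Ω * (P.W + E + Real.log (2 * P.Amax)) := by ring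
      _ ≤ C n * P.Ω * (P.W + E + Real.log (2 * P.Amax)) := by gcongr; exact hCg r hr

/-- Positivity of p4's `Pmax` for the record's parameters. [folklore] -/
theorem Q_pos (r d₀ : ℕ) :
    0 < ((r ! : ℕ) : ℝ) ^ 2 * (n : ℝ) ^ r *
        (((((n + 1)! * 2 ^ n * P.D₀ : ℕ) : ℝ) * ((P.Nq : ℝ) * P.L / 2 ^ P.Sdepth + P.Amax) ^ r /
          ((Nat.choose (P.S₀N + (r - d₀)) (r - d₀) * (2 * P.Xfin + 1) *
            ((d₀ + (n - r))! * 2 ^ (n - r) * P.D₀ ^ d₀) : ℕ) : ℝ))) := by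
  have hden := P.den_pos r d₀
  have hΛ : 0 < (P.Nq : ℝ) * P.L / 2 ^ P.Sdepth + P.Amax := by
    have := P.hAmax1; positivity
  have hn : (0 : ℝ) < n := by exact_mod_cast P.hn
  have hr : (0 : ℝ) < ((r ! : ℕ) : ℝ) := by exact_mod_cast Nat.factorial_pos r
  have hN : (0 : ℝ) < (((n + 1)! * 2 ^ n * P.D₀ : ℕ) : ℝ) := by
    have : 0 < P.D₀ := by unfold D₀; omega
    positivity
  positivity

/-- **Clause (C) for the `p = 2` record**: hypothesis `hCineq` of `RecordAssembly.recordTwo_of_ineqs` for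
`(P.A, P.Amax, P.W, P.D₀, P.S₀N, P.Xfin)` and the box `Λ = ρ + Amax`, from the convention facts, the
growth `256^{n−r}·C r ≤ C n`, and the constant comparisons `NC1`/`NC0`.
[cite: Nesterenko2003, §5.2 (5.22)] -/
theorem exitC_two (hKNq : P.K ≤ P.Nq) (hNqK : P.Nq ≤ 2 ^ n * P.K) (hθ : (1 / 2 : ℝ) ≤ P.θ₀)
    (hAmax : P.Amax ≤ 2 ^ n * P.Ω) (hA1 : ∀ j, 1 ≤ P.A j)
    {C : ℕ → ℝ} (hC0 : ∀ r, 0 ≤ C r) (hCg : ∀ r, r < n → (256 : ℝ) ^ (n - r) * C r ≤ C n)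
    (hnum1 : ∀ r : ℕ, 0 < r → r < n →
      ((r ! : ℕ) : ℝ) ^ 2 * (n : ℝ) ^ r * (((n + 1)! : ℕ) : ℝ) * 2 ^ r * (((r - 1)! : ℕ) : ℝ) *
          (((2 : ℝ) ^ (n + 23))⁻¹ + 2 ^ n / (24 * Cb ^ n)) ^ r * (264 * Cb ^ n + 2 ^ (2 * n + 26)) *
          (14 * n + 3) ≤
        (256 : ℝ) ^ (n - r) * (16 * ((n : ℝ) + 1) / ((n : ℝ) + 2) ^ 4) ^ (r - 1) * 2 ^ (n + 22) *
          (((n - r + 1)! : ℕ) : ℝ))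
    (hnum0 : ∀ r : ℕ, 0 < r → r < n →
      ((r ! : ℕ) : ℝ) ^ 3 * (n : ℝ) ^ r * (((n + 1)! : ℕ) : ℝ) * 2 ^ (r - 1) *
          (((2 : ℝ) ^ (n + 23))⁻¹ + 2 ^ n / (24 * Cb ^ n)) ^ r * (264 * Cb ^ n + 2 ^ (2 * n + 26)) *
          (14 * n + 3) ≤
        (256 : ℝ) ^ (n - r) * (16 * ((n : ℝ) + 1) / ((n : ℝ) + 2) ^ 4) ^ r * 2 ^ (n + 22) *
          (((n - r)! : ℕ) : ℝ)) :
    ∀ r d₀ : ℕ, 0 < r → r < n → d₀ ≤ 1 →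
      C r * (((r.factorial : ℝ)) ^ 2 * (n : ℝ) ^ r *
              ((((n + 1).factorial * 2 ^ n * P.D₀ : ℕ) : ℝ) *
                ((P.Nq : ℝ) * P.L / 2 ^ P.Sdepth + P.Amax) ^ r /
                ((Nat.choose (P.S₀N + (r - d₀)) (r - d₀) * (2 * P.Xfin + 1) *
                  ((d₀ + (n - r)).factorial * 2 ^ (n - r) * P.D₀ ^ d₀) : ℕ) : ℝ))) *
          (P.W + Real.log 3 + Real.log n + Real.log P.Amax +
            Real.log (((r.factorial : ℝ)) ^ 2 * (n : ℝ) ^ r *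
              ((((n + 1).factorial * 2 ^ n * P.D₀ : ℕ) : ℝ) *
                ((P.Nq : ℝ) * P.L / 2 ^ P.Sdepth + P.Amax) ^ r /
                ((Nat.choose (P.S₀N + (r - d₀)) (r - d₀) * (2 * P.Xfin + 1) *
                  ((d₀ + (n - r)).factorial * 2 ^ (n - r) * P.D₀ ^ d₀) : ℕ) : ℝ))) +
            Real.log (2 * (((r.factorial : ℝ)) ^ 2 * (n : ℝ) ^ r *
              ((((n + 1).factorial * 2 ^ n * P.D₀ : ℕ) : ℝ) *
                ((P.Nq : ℝ) * P.L / 2 ^ P.Sdepth + P.Amax) ^ r /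
                ((Nat.choose (P.S₀N + (r - d₀)) (r - d₀) * (2 * P.Xfin + 1) *
                  ((d₀ + (n - r)).factorial * 2 ^ (n - r) * P.D₀ ^ d₀) : ℕ) : ℝ))))) ≤
        C n * (∏ j, P.A j) * (P.W + Real.log (2 * P.Amax)) := by
  intro r d₀ hr0 hrn hd₀
  have hQ0 := P.Q_pos r d₀
  set Q := ((r ! : ℕ) : ℝ) ^ 2 * (n : ℝ) ^ r *
        (((((n + 1)! * 2 ^ n * P.D₀ : ℕ) : ℝ) * ((P.Nq : ℝ) * P.L / 2 ^ P.Sdepth + P.Amax) ^ r /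
          ((Nat.choose (P.S₀N + (r - d₀)) (r - d₀) * (2 * P.Xfin + 1) *
            ((d₀ + (n - r))! * 2 ^ (n - r) * P.D₀ ^ d₀) : ℕ) : ℝ))) with hQdef
  have hQ : Q * (14 * n + 3) ≤ (256 : ℝ) ^ (n - r) * P.Ω := by
    rcases Nat.le_one_iff_eq_zero_or_eq_one.mp hd₀ with rfl | rfl
    · exact P.Q_mul_le_zero hKNq hNqK hθ hAmax hA1 hr0 hrn (hnum0 r hr0 hrn)
    · exact P.Q_mul_le_one hKNq hNqK hθ hAmax hA1 hr0 hrn (hnum1 r hr0 hrn)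
  have h := P.clauseC_final hC0 hCg hrn hQ0 le_rfl hQ
  simpa only [add_zero] using h

/-- **Clause (C) for the odd-`p` record**: hypothesis `hCineq` of `RecordAssembly.recordOdd_of_ineqs` (the
`p = 2` line with `+ log p` on both sides), same hypotheses. [cite: Nesterenko2003, §5.2 (5.22)] -/
theorem exitC_odd (hKNq : P.K ≤ P.Nq) (hNqK : P.Nq ≤ 2 ^ n * P.K) (hθ : (1 / 2 : ℝ) ≤ P.θ₀)
    (hAmax : P.Amax ≤ 2 ^ n * P.Ω) (hA1 : ∀ j, 1 ≤ P.A j) (p : ℕ)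
    {C : ℕ → ℝ} (hC0 : ∀ r, 0 ≤ C r) (hCg : ∀ r, r < n → (256 : ℝ) ^ (n - r) * C r ≤ C n)
    (hnum1 : ∀ r : ℕ, 0 < r → r < n →
      ((r ! : ℕ) : ℝ) ^ 2 * (n : ℝ) ^ r * (((n + 1)! : ℕ) : ℝ) * 2 ^ r * (((r - 1)! : ℕ) : ℝ) *
          (((2 : ℝ) ^ (n + 23))⁻¹ + 2 ^ n / (24 * Cb ^ n)) ^ r * (264 * Cb ^ n + 2 ^ (2 * n + 26)) *
          (14 * n + 3) ≤
        (256 : ℝ) ^ (n - r) * (16 * ((n : ℝ) + 1) / ((n : ℝ) + 2) ^ 4) ^ (r - 1) * 2 ^ (n + 22) *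
          (((n - r + 1)! : ℕ) : ℝ))
    (hnum0 : ∀ r : ℕ, 0 < r → r < n →
      ((r ! : ℕ) : ℝ) ^ 3 * (n : ℝ) ^ r * (((n + 1)! : ℕ) : ℝ) * 2 ^ (r - 1) *
          (((2 : ℝ) ^ (n + 23))⁻¹ + 2 ^ n / (24 * Cb ^ n)) ^ r * (264 * Cb ^ n + 2 ^ (2 * n + 26)) *
          (14 * n + 3) ≤
        (256 : ℝ) ^ (n - r) * (16 * ((n : ℝ) + 1) / ((n : ℝ) + 2) ^ 4) ^ r * 2 ^ (n + 22) *
          (((n - r)! : ℕ) : ℝ)) :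
    ∀ r d₀ : ℕ, 0 < r → r < n → d₀ ≤ 1 →
      C r * (((r.factorial : ℝ)) ^ 2 * (n : ℝ) ^ r *
              ((((n + 1).factorial * 2 ^ n * P.D₀ : ℕ) : ℝ) *
                ((P.Nq : ℝ) * P.L / 2 ^ P.Sdepth + P.Amax) ^ r /
                ((Nat.choose (P.S₀N + (r - d₀)) (r - d₀) * (2 * P.Xfin + 1) *
                  ((d₀ + (n - r)).factorial * 2 ^ (n - r) * P.D₀ ^ d₀) : ℕ) : ℝ))) *
          (P.W + Real.log 3 + Real.log n + Real.log P.Amax +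
            Real.log (((r.factorial : ℝ)) ^ 2 * (n : ℝ) ^ r *
              ((((n + 1).factorial * 2 ^ n * P.D₀ : ℕ) : ℝ) *
                ((P.Nq : ℝ) * P.L / 2 ^ P.Sdepth + P.Amax) ^ r /
                ((Nat.choose (P.S₀N + (r - d₀)) (r - d₀) * (2 * P.Xfin + 1) *
                  ((d₀ + (n - r)).factorial * 2 ^ (n - r) * P.D₀ ^ d₀) : ℕ) : ℝ))) +
            Real.log p +
            Real.log (2 * (((r.factorial : ℝ)) ^ 2 * (n : ℝ) ^ r *
              ((((n + 1).factorial * 2 ^ n * P.D₀ : ℕ) : ℝ) *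
                ((P.Nq : ℝ) * P.L / 2 ^ P.Sdepth + P.Amax) ^ r /
                ((Nat.choose (P.S₀N + (r - d₀)) (r - d₀) * (2 * P.Xfin + 1) *
                  ((d₀ + (n - r)).factorial * 2 ^ (n - r) * P.D₀ ^ d₀) : ℕ) : ℝ))))) ≤
        C n * (∏ j, P.A j) * (P.W + Real.log p + Real.log (2 * P.Amax)) := by
  intro r d₀ hr0 hrn hd₀
  have hQ0 := P.Q_pos r d₀
  set Q := ((r ! : ℕ) : ℝ) ^ 2 * (n : ℝ) ^ r *
        (((((n + 1)! * 2 ^ n * P.D₀ : ℕ) : ℝ) * ((P.Nq : ℝ) * P.L / 2 ^ P.Sdepth + P.Amax) ^ r /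
          ((Nat.choose (P.S₀N + (r - d₀)) (r - d₀) * (2 * P.Xfin + 1) *
            ((d₀ + (n - r))! * 2 ^ (n - r) * P.D₀ ^ d₀) : ℕ) : ℝ))) with hQdef
  have hQ : Q * (14 * n + 3) ≤ (256 : ℝ) ^ (n - r) * P.Ω := by
    rcases Nat.le_one_iff_eq_zero_or_eq_one.mp hd₀ with rfl | rfl
    · exact P.Q_mul_le_zero hKNq hNqK hθ hAmax hA1 hr0 hrn (hnum0 r hr0 hrn)
    · exact P.Q_mul_le_one hKNq hNqK hθ hAmax hA1 hr0 hrn (hnum1 r hr0 hrn)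
  exact P.clauseC_final hC0 hCg hrn hQ0 (Real.log_natCast_nonneg p) hQ

end PadicG3Par

end Summit.ABC.StewartYu

end
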